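import Summits.CriticalPhenomena.PercolationContinuityZ3.Theorems.Transplant.SkelPhiCorridorKGYKits
import Summits.CriticalPhenomena.PercolationContinuityZ3.Theorems.Transplant.SkelPhiCorridorKGRoute
import HarnessLib

/-!
# N2 (frames-only node `SamePDropOfSkeletonFrm₁`, OPEN), (C) column: **THE PER-STEP PER-CENTRE INPUT OF THE SECOND-AXIS K-G CORRIDOR OF RECORD, BY PHASE** —
# `Skelφ.hrouteS_kgCorrY`: the hypothesis `hrouteS` of `hkits_schedFHab` (SkelPhiCorridorStepsFHab) for `S := kgCorrSchedY hn hv hlay hP₁ hP₂ hsplit`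
# (SkelPhiParaCorridorKGY) read in the frame `runX φ c₀ n h σ` over a habitat `Ω`, from the LONG LINKS at every centre (top pieces for the
# y′-run and the along-parking, side halves for the across-parking) at accuracy `δ³`: step `k` is dispatched to `hroute_yRunBIn` (`k ≤ N`),
# `hroute_xParkCIn` (`k = N+1+j`, `j ≤ m₁`) or `hroute_yParkCIn` (`k = N+1+m₁+1+j`) through the phase views `corrSchedNP_run/park₁/park₂` and the
# two joins `kgJoin₁Y/kgJoin₂Y` at the phase boundaries (the next core of the last step of a phase is the first core of the next phase).

builds on p205010 (kernel theorem, internal audit signed; external expert review pending) — nothing in this file uses p205010; nothing here is a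
claim about the open node `SamePDropOfSkeletonFrm₁`.
Lane `prim-bschramm`, seat `prim-bschramm-p5` (gen 15; (C) lineage; (R-22) K-G); helper file (`--supports stmt-CriticalPhenomena-4575 --as helper`).
* §1 phase views of `kgCorrSchedY`: `kgCorrSchedY_run_view`, `kgCorrSchedY_core_succ_run`, `kgCorrSchedY_park₁_view`, `kgCorrSchedY_core_succ_park₁`,
  `kgCorrSchedY_park₂_view`, `kgCorrSchedY_core_succ_park₂` (the step trichotomy is `kgCorrSched_step_cases`, SkelPhiCorridorKGRoute);
* §2 **`hrouteS_kgCorrY`**.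
[cite: KozmaNitzan2024, §4 Lemma 10 Step IV (pp. 20–21), Lemma 11 (pp. 22–23), Lemma 12 (pp. 23–25)] [cite: MartineauTassion2017, §4.3 Lemma 4.2]
-/

noncomputable section

open scoped Classical

namespace Summit.CriticalPhenomena.PercolationContinuityZ3.Theorems.Transplant

namespace Skelφ

open MeasureTheory
open Literature.Probability.Percolation Literature.Probability.LatticeModels SimpleGraph KNLevels
open Literature.Barriers.CriticalPhenomena (graphBall graphBall_mono)
open Skel (winGraph winGraph_le winGraphIn winGraphIn_le)
open Literature.Probability.Percolation.KozmaNitzan.Cells (oth)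
open ChainPlanar ChainPara

variable {V : Type} [DecidableEq V] [Countable V] {G : SimpleGraph V} [G.LocallyFinite] {φ : V → Site 2}

section KG

variable {n ℓ : ℕ} {h v : ℤ} {R' ρ q W N m₁ Wm₂ Wp₂ m₂ : ℕ} (hn : 1 ≤ n) (hv : |v| ≤ n) (hlay : (n + h.natAbs : ℕ) ≤ (n : ℤ) * ℓ + 1)
  (hP₁ : ParkOK (kgPark₁Y n ℓ h v R' ρ q W N m₁)) (hP₂ : ParkOK (kgPark₂Y n ℓ h v R' ρ q W N m₁ Wm₂ Wp₂ m₂))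
  (hsplit : (Wm₂ : ℤ) + Wp₂ = (kgPark₁Y n ℓ h v R' ρ q W N m₁).aHi (m₁ + 1) - ParkPrm.aLo (kgPark₁Y n ℓ h v R' ρ q W N m₁) (m₁ + 1))

/-- `oth (oth 0) = 0`. [folklore] -/
private theorem oth_oth_zero' : oth (oth (0 : Fin 2)) = 0 := by decide

/-! ## §1 The phase views of the corridor of record -/

/-- **Run phase view** (`k ≤ N`): region, levels and core of `kgCorrSchedY` are those of `yRunSchedB`. [folklore] -/
theorem kgCorrSchedY_run_view {k : ℕ} (hk : k ≤ N) :
    (kgCorrSchedY hn hv hlay hP₁ hP₂ hsplit).region k = (yRunSchedB hn hv hlay R' q W N).region k ∧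
    (∀ i, (kgCorrSchedY hn hv hlay hP₁ hP₂ hsplit).level k i = (yRunSchedB hn hv hlay R' q W N).level k i) ∧
    (kgCorrSchedY hn hv hlay hP₁ hP₂ hsplit).core k = (yRunSchedB hn hv hlay R' q W N).core k := by
  obtain ⟨-, hreg, hlev, hcore⟩ := corrSchedNP_run (yRunPrmB n ℓ h v R' q W N) (kgPark₁Y n ℓ h v R' ρ q W N m₁)
    (kgPark₂Y n ℓ h v R' ρ q W N m₁ Wm₂ Wp₂ m₂) (oth 0) (σ := 1) (Or.inl rfl) 0 (kgC₁Y n ℓ h v N) (kgC₂Y n ℓ h v R' ρ q W N m₁ Wp₂)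
    (yRunPrmB_ok hn hv hlay R' q W N) (yRunPrmB_eb n ℓ h v R' q W N) hP₁ (xParkPrmW_eb n ℓ h R' ρ _ _ _ _ m₁) hP₂
    (yParkPrmW_eb n ℓ h v R' ρ _ _ _ _ m₂) rfl rfl rfl (kgJoin₁Y hn hv hlay hP₁) (kgJoin₂Y hP₁ hP₂ hsplit) hk
  exact ⟨hreg, fun i => hlev i, hcore⟩

/-- **Across-parking phase view** (`k = N + 1 + j`, `j ≤ m₁`). [folklore] -/
theorem kgCorrSchedY_park₁_view {j : ℕ} (hj : j ≤ m₁) :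
    (kgCorrSchedY hn hv hlay hP₁ hP₂ hsplit).region (N + 1 + j) = (xParkSchedC hP₁ (kgC₁Y n ℓ h v N)).region j ∧
    (∀ i, (kgCorrSchedY hn hv hlay hP₁ hP₂ hsplit).level (N + 1 + j) i = (xParkSchedC hP₁ (kgC₁Y n ℓ h v N)).level j i) ∧
    (kgCorrSchedY hn hv hlay hP₁ hP₂ hsplit).core (N + 1 + j) = (xParkSchedC hP₁ (kgC₁Y n ℓ h v N)).core j := by
  obtain ⟨-, hreg, hlev, hcore⟩ := corrSchedNP_park₁ (yRunPrmB n ℓ h v R' q W N) (kgPark₁Y n ℓ h v R' ρ q W N m₁)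
    (kgPark₂Y n ℓ h v R' ρ q W N m₁ Wm₂ Wp₂ m₂) (oth 0) (σ := 1) (Or.inl rfl) 0 (kgC₁Y n ℓ h v N) (kgC₂Y n ℓ h v R' ρ q W N m₁ Wp₂)
    (yRunPrmB_ok hn hv hlay R' q W N) (yRunPrmB_eb n ℓ h v R' q W N) hP₁ (xParkPrmW_eb n ℓ h R' ρ _ _ _ _ m₁) hP₂
    (yParkPrmW_eb n ℓ h v R' ρ _ _ _ _ m₂) rfl rfl rfl (kgJoin₁Y hn hv hlay hP₁) (kgJoin₂Y hP₁ hP₂ hsplit) hj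
  simp only [oth_oth_zero'] at hreg hlev hcore
  exact ⟨hreg, fun i => hlev i, hcore⟩

/-- **Along-parking phase view** (`k = N + 1 + m₁ + 1 + j`). [folklore] -/
theorem kgCorrSchedY_park₂_view (j : ℕ) :
    (kgCorrSchedY hn hv hlay hP₁ hP₂ hsplit).region (N + 1 + m₁ + 1 + j) = (yParkSchedC hP₂ (kgC₂Y n ℓ h v R' ρ q W N m₁ Wp₂)).region j ∧
    (∀ i, (kgCorrSchedY hn hv hlay hP₁ hP₂ hsplit).level (N + 1 + m₁ + 1 + j) i = (yParkSchedC hP₂ (kgC₂Y n ℓ h v R' ρ q W N m₁ Wp₂)).level j i) ∧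
    (kgCorrSchedY hn hv hlay hP₁ hP₂ hsplit).core (N + 1 + m₁ + 1 + j) = (yParkSchedC hP₂ (kgC₂Y n ℓ h v R' ρ q W N m₁ Wp₂)).core j := by
  obtain ⟨-, hreg, hlev, hcore⟩ := corrSchedNP_park₂ (yRunPrmB n ℓ h v R' q W N) (kgPark₁Y n ℓ h v R' ρ q W N m₁)
    (kgPark₂Y n ℓ h v R' ρ q W N m₁ Wm₂ Wp₂ m₂) (oth 0) (σ := 1) (Or.inl rfl) 0 (kgC₁Y n ℓ h v N) (kgC₂Y n ℓ h v R' ρ q W N m₁ Wp₂)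
    (yRunPrmB_ok hn hv hlay R' q W N) (yRunPrmB_eb n ℓ h v R' q W N) hP₁ (xParkPrmW_eb n ℓ h R' ρ _ _ _ _ m₁) hP₂
    (yParkPrmW_eb n ℓ h v R' ρ _ _ _ _ m₂) rfl rfl rfl (kgJoin₁Y hn hv hlay hP₁) (kgJoin₂Y hP₁ hP₂ hsplit) j
  exact ⟨hreg, fun i => hlev i, hcore⟩

/-- **The next core of a run step is the run's next core** (at `k = N` through the first join). [folklore] -/
theorem kgCorrSchedY_core_succ_run {k : ℕ} (hk : k ≤ N) :
    (kgCorrSchedY hn hv hlay hP₁ hP₂ hsplit).core (k + 1) = (yRunSchedB hn hv hlay R' q W N).core (k + 1) := by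
  rcases Nat.lt_or_eq_of_le hk with hlt | rfl
  · exact (kgCorrSchedY_run_view hn hv hlay hP₁ hP₂ hsplit (k := k + 1) (by omega)).2.2
  · rw [show k + 1 = k + 1 + 0 by rfl, (kgCorrSchedY_park₁_view hn hv hlay hP₁ hP₂ hsplit (j := 0) (Nat.zero_le _)).2.2]
    exact kgJoin₁Y hn hv hlay hP₁

/-- **The next core of an across-parking step** (at `j = m₁` through the second join). [folklore] -/
theorem kgCorrSchedY_core_succ_park₁ {j : ℕ} (hj : j ≤ m₁) :
    (kgCorrSchedY hn hv hlay hP₁ hP₂ hsplit).core (N + 1 + j + 1) = (xParkSchedC hP₁ (kgC₁Y n ℓ h v N)).core (j + 1) := by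
  rcases Nat.lt_or_eq_of_le hj with hlt | rfl
  · rw [show N + 1 + j + 1 = N + 1 + (j + 1) by omega]
    exact (kgCorrSchedY_park₁_view hn hv hlay hP₁ hP₂ hsplit (j := j + 1) (by omega)).2.2
  · rw [show N + 1 + j + 1 = N + 1 + j + 1 + 0 by rfl, (kgCorrSchedY_park₂_view hn hv hlay hP₁ hP₂ hsplit 0).2.2]
    have hJ := kgJoin₂Y hP₁ hP₂ hsplit
    simp only [oth_oth_zero'] at hJ
    exact hJ

/-- **The next core of an along-parking step.** [folklore] -/
theorem kgCorrSchedY_core_succ_park₂ (j : ℕ) :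
    (kgCorrSchedY hn hv hlay hP₁ hP₂ hsplit).core (N + 1 + m₁ + 1 + j + 1) = (yParkSchedC hP₂ (kgC₂Y n ℓ h v R' ρ q W N m₁ Wp₂)).core (j + 1) := by
  rw [show N + 1 + m₁ + 1 + j + 1 = N + 1 + m₁ + 1 + (j + 1) by omega]
  exact (kgCorrSchedY_park₂_view hn hv hlay hP₁ hP₂ hsplit (j + 1)).2.2

/-! ## §2 The per-step per-centre input of the corridor of record -/

/-- **THE PER-STEP PER-CENTRE PARKED-OR-ROUTED INPUT OF THE SECOND-AXIS K-G CORRIDOR OF RECORD** (`hrouteS` of `hkits_schedFHab` at `S := kgCorrSchedY …`): from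
the long x-links (side halves, both transverse signs) and the long y′-links (top pieces, both signs) at every centre at accuracy `δ³`, the window-in-
habitat row and a sub-box law on every region window. [cite: KozmaNitzan2024, §4 Lemma 10 Step IV, Lemma 12] [cite: MartineauTassion2017, §4.3 Lemma 4.2] -/
theorem hrouteS_kgCorrY (c₀ : V) {σ : ℤ} (hσ : σ = 1 ∨ σ = -1) {w₀ : V} {R r Rl : ℕ} (hr : Rl ≤ r) (hrR : r ≤ R)
    {Ω : Finset V} (hΩball : ∀ u ∈ graphBall G w₀ R, runX φ c₀ n h σ u ∈ (kgCorrSchedY hn hv hlay hP₁ hP₂ hsplit).prism → u ∈ Ω) (Rim : ℕ → Finset V)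
    {q' : unitInterval} {W' : Sym2 V → unitInterval}
    (hWD : ∀ k ≤ (kgCorrSchedY hn hv hlay hP₁ hP₂ hsplit).N, IsSubbox (winGraphIn G Ω) W' q' (WinIn (runX φ c₀ n h σ) Ω ((kgCorrSchedY hn hv hlay hP₁ hP₂ hsplit).region k)))
    (Λc : V → ℕ → Finset V) (kz : ℕ) {δ : ℝ}
    (hlong : ∀ c (τ : ℤ), τ = 1 ∨ τ = -1 → 1 - δ ^ 3 < (bondPercolation G q').real
      (linkIn (pgramPrism G φ c n h (3 * ℓ) Rl) (Λc c kz) (pgSideHalfW G φ c n h ℓ Rl σ (σ * τ))))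
    (hlongY : ∀ c (τ : ℤ), τ = 1 ∨ τ = -1 → 1 - δ ^ 3 < (bondPercolation G q').real
      (linkIn (pgramPrism G φ c n h (3 * ℓ) Rl) (Λc c kz) (pgTopPieceW G φ c n h ℓ Rl σ τ v))) :
    ∀ k ≤ (kgCorrSchedY hn hv hlay hP₁ hP₂ hsplit).N, ∀ c : V,
      runX φ c₀ n h σ c ∈ Finset.Icc ((kgCorrSchedY hn hv hlay hP₁ hP₂ hsplit).lo k - (((kgCorrSchedY hn hv hlay hP₁ hP₂ hsplit).R' : ℕ) : Site 2))
        ((kgCorrSchedY hn hv hlay hP₁ hP₂ hsplit).hi k + (((kgCorrSchedY hn hv hlay hP₁ hP₂ hsplit).R' : ℕ) : Site 2)) → c ∈ graphBall G w₀ (R - r) →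
      c ∈ WinIn (runX φ c₀ n h σ) Ω (ScheduleNP.core (kgCorrSchedY hn hv hlay hP₁ hP₂ hsplit) (k + 1)) ∪ Rim k ∨
      ∃ Qt Ft : Finset V, Ft ⊆ WinIn (runX φ c₀ n h σ) Ω (ScheduleNP.core (kgCorrSchedY hn hv hlay hP₁ hP₂ hsplit) (k + 1)) ∪ Rim k ∧
        Qt ⊆ WinIn (runX φ c₀ n h σ) Ω ((kgCorrSchedY hn hv hlay hP₁ hP₂ hsplit).region k) ∧
        1 - δ ^ 3 ≤ (prodBernoulli W').real (linkIn (↑Qt : Set V) (Λc c kz) Ft) := by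
  set S := kgCorrSchedY hn hv hlay hP₁ hP₂ hsplit with hS
  set ψ := runX φ c₀ n h σ with hψ
  have hSN : S.N = N + 1 + m₁ + 1 + m₂ := rfl
  have hSR : S.R' = R' := rfl
  intro k hk c hc hcw
  -- generic transport: a plain window over a phase region / next core lies in the habitat window of the corridor's
  have hPDof : ∀ {Reg : Finset (Site 2)}, Reg = S.region k → Win G ψ w₀ Reg R ⊆ WinIn ψ Ω (S.region k) := by
    intro Reg hReg u hu
    obtain ⟨huB, huP⟩ := (mem_Win G _).1 hu
    rw [hReg] at huP
    exact (mem_WinIn (φ := ψ)).2 ⟨hΩball u huB (S.sub_prism k hk huP), huP⟩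
  have hPTof : ∀ {Cor : Finset (Site 2)}, Cor = ScheduleNP.core S (k + 1) → Win G ψ w₀ Cor R ⊆ WinIn ψ Ω (ScheduleNP.core S (k + 1)) ∪ Rim k := by
    intro Cor hCor u hu
    obtain ⟨huB, huP⟩ := (mem_Win G _).1 hu
    rw [hCor] at huP
    exact Finset.mem_union_left _ ((mem_WinIn (φ := ψ)).2 ⟨hΩball u huB (S.sub_prism k hk (S.succ k hk huP)), huP⟩)
  have hDrΩ : WinIn ψ Ω (S.region k) ⊆ Ω := fun u hu => ((mem_WinIn (φ := ψ)).1 hu).1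
  have hc' : ψ c ∈ ScheduleNP.level S k S.R' := hc
  rcases kgCorrSched_step_cases (N := N) (m₁ := m₁) (m₂ := m₂) (k := k) (hk.trans_eq hSN) with hkN | ⟨j, hj, rfl⟩ | ⟨j, hj, rfl⟩
  · -- y′-run phase
    obtain ⟨hreg, hlev, -⟩ := kgCorrSchedY_run_view hn hv hlay hP₁ hP₂ hsplit hkN
    have hcs := kgCorrSchedY_core_succ_run hn hv hlay hP₁ hP₂ hsplit hkN
    rw [hlev] at hc'
    exact hroute_yRunBIn (φ := φ) hn hv hlay R' q W N c₀ hσ (k := k) hr hrR (hPDof hreg.symm) (hPTof hcs.symm) hDrΩ (hWD k hk) Λc kz hlongY c hc' hcw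
  · -- across-parking phase
    obtain ⟨hreg, hlev, -⟩ := kgCorrSchedY_park₁_view hn hv hlay hP₁ hP₂ hsplit hj
    have hcs := kgCorrSchedY_core_succ_park₁ hn hv hlay hP₁ hP₂ hsplit hj
    rw [hlev] at hc'
    exact hroute_xParkCIn (φ := φ) hP₁ (kgC₁Y n ℓ h v N) hn c₀ hσ (k := j) hr hrR (hPDof hreg.symm) (hPTof hcs.symm) hDrΩ (hWD _ hk) Λc kz hlong
      c hc' hcw
  · -- along-parking phase
    obtain ⟨hreg, hlev, -⟩ := kgCorrSchedY_park₂_view hn hv hlay hP₁ hP₂ hsplit j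
    have hcs := kgCorrSchedY_core_succ_park₂ hn hv hlay hP₁ hP₂ hsplit j
    rw [hlev] at hc'
    exact hroute_yParkCIn (φ := φ) hP₂ (kgC₂Y n ℓ h v R' ρ q W N m₁ Wp₂) hn c₀ hσ (k := j) hr hrR (hPDof hreg.symm) (hPTof hcs.symm) hDrΩ
      (hWD _ hk) Λc kz hlongY c hc' hcw

end KG

end Skelφ

end Summit.CriticalPhenomena.PercolationContinuityZ3.Theorems.Transplant

end
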